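import Summits.QuantumFields.QCD.Theorems.SpectralDefectExtinctionChiralDescentSharedChiralItems
import Summits.QuantumFields.QCD.Theorems.SpectralDefectExtinctionChiralDescentWallContent
import Summits.QuantumFields.QCD.Theorems.ChiralDescent.Negative.DataLevelObstruction
import Summits.QuantumFields.QCD.Theorems.ChiralDescent.Negative.FlavourGuard
import Summits.QuantumFields.QCD.Theorems.RobustYangMillsHandover.Negative.SchemeAsymptotics
import Summits.QuantumFields.QCD.Theorems.SpectralDefectExtinctionChiralDescentWallLimit
import Summits.QuantumFields.QCD.Theses.EulerDescent

/-!
# Line `gap-upset-recut` for crux `SpectralDefectExtinction.ChiralDescent`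
# (item stmt-QuantumFields-17527, route route-QuantumFields-SpectralDefectExtinction; crux-plan of the round-2 idea
# `Ideas/gap-upset-recut.md`, triage TRIAGE-r2-1 / TRIAGE-r2-2 both PASS; planner skeleton, 2026-08-17)

THE IDEA.  The dead line `Sketch` (infimum descent, `Lines/Sketch-dead.md`) cut the per-regularisation target
E = "the threshold regularisation carries the body above an offset at which it has NO uniform lattice rate" into
H1 ("no uniform rate at the minimum `μ*` of the BODY up-set `S(reg) = {μ | body above μ}`", ⇔ item 18327
`MassContinuation`) ∧ H2, and died at H1: continuation of the body into territory about which nothing is known.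
This line cuts E with a SECOND up-set, the UNIFORM-GAP up-set
`G(reg) = {μ | ∃ ε > 0, every tuple above μ has the lattice rate ε}` (body-free: reads only `β_k, L_k, a_k, m_f(k)`):

  E ⇐ (Q1) body at every real tuple ⇒ some offset is not in `G`            [`stub_chiralPointOfBodyEverywhere`]
      (Q2) `G` NEVER STARTS AT A BODY OFFSET: μ ∈ S ∩ G ⇒ some μ' < μ lies in G   [`stub_gapUpsetNoStart`, NEW]
      (Q3) THE BODY FOLLOWS THE GAP: μ' < ν, μ' ∈ G, ν ∈ S ⇒ ν − δ ∈ S           [`stub_bodyIntoGap`]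
  at `μ* = min S` (attained, `forall_above_csInf` p134498): `μ* ∈ G` would give (Q2) a certified-gapped orthant strictly
  below `μ*` and (Q3) would move the body into it — against minimality; `S = ℝ` is excluded by (Q1).

Q2 and Q3 are typed for INTERIOR regularisations (`∃ c > −1, ∀ᶠ k, c ≤ m_crit k` — triage sharpenings r2-1 (s1) /
r2-2), so that Q3 is LITERALLY an instance of the staffed crux `EulerDescent.RetypedContinuumComplement` (stmt-16903,
adapter `stub_bodyIntoGap_of_retypedContinuumComplement` below, sorry-free) and the hidden wall content of H1
(`openness_denies_gapped_body_at_wall`, p136901) is NOT inside any ∀-reg stub: the wall regime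
(`lim inf m_crit ≤ −1`: bare masses of every fixed tuple frequently at the cutoff scale) is the separate no-go
`stub_wallNoGo` (W; cf. S5 of `Lines/saturated_infimum.lean`, here in the `∃ᶠ` form so that the glue needs no reindexing).

THE FOUR REGISTERED STUBS (the ONLY sorries of this file; N_f ∈ {2,3} throughout):
* W  `stub_wallLimitNoGo` (REGISTERED since lead c11's reshape; the planner's `lim inf` form `stub_wallNoGo` is now DERIVED from it by
     the landed `WallLimit.wallNoGo_of_wallLimitNoGo`, and the two are equivalent, `wallNoGo_iff_wallLimitNoGo`) — a mass-scaling
     regularisation with `m_crit(k) → −1` carries the body above NO offset (decoupling of cutoff-mass quarks kills the flavour-changing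
     pseudoscalars of the OS limit). No-go, corner case; open-problem grade (supercritical localisation), not M–L — and REMOVABLE: under the
     interior re-type of the crux antecedent the composition needs only Q1–Q3 (`ChiralDescentInterior_of_stubs`).
* Q1 `stub_chiralPointOfBodyEverywhere` — VERBATIM the shared stub H2 / S4 of lines `Sketch` / `saturated_infimum`; ⇐ item
     18328 `ChiralTupleGapless` (landed `chiralPointOfBodyEverywhere_of_chiralTupleGapless`, p139859; re-exported below).
* Q2 `stub_gapUpsetNoStart` — interior mass-scaling `reg`, body above `μ`, ONE rate above `μ` ⇒ one rate above some
     `μ' < μ`. Conclusion LATTICE-ONLY. Content: no `k`-asymptotic lattice-gap WALL at a body offset — at a PCAC-chiral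
     corner the anomaly / Goldstone-flux engines by contradiction (first lemmas p134287 / p134184), at a PCAC-massive corner
     `k`-uniform openness of exponential clustering in the renormalised mass (finite-size-criterion class, hub item 11448;
     above a PINNED corner it is the conclusion shape of `EulerDescent.RayDescent`, stmt-16900 —
     `uniformGapAbove_descend_of_rayDescent` below, sorry-free). The NEW statement of the line.
* Q3 `stub_bodyIntoGap` — interior mass-scaling `reg`, one rate above `μ`, `μ < ν`, body above `ν` ⇒ body above `ν − δ`:
     light-quark continuation INTO certified-gapped territory (fermionic UV stability + mass-equicontinuity WITH the IR
     modulus supplied). Strictly weaker than item 18327 (`stub_bodyIntoGap_of_massContinuation`) and implied by item 16903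
     (`stub_bodyIntoGap_of_retypedContinuumComplement`), both sorry-free below. The hardest stub by size (XL construction).

COMPOSITION (`ChiralDescent_of_stubs`, `ChiralDescent_of`; sorry-free): threshold `reg` with body above `M₁` ⇒ either the
wall regime (W: contradiction) or `reg` is interior ⇒ `exists_above_not_gap_of_gapUpset` (Q1, Q2, Q3) gives an offset `μ`
with the body above `μ` and `μ ∉ G(reg)` ⇒ the `m_crit`-shift of `reg` by `μ` witnesses `QCDOf N_f`
(`qcdOf_of_bodyAbove_of_noUniformGapAbove`, p134498).

CERTIFIED BOOKKEEPING (triage r2-1 (s3), so that no later seat re-derives the card's objection 11): `openness_of_gapUpset`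
((Q2 ∧ Q3) ⇒ H1-openness), `bodyIntoGap_of_openness` (H1 ⇒ Q3), `q2_at_min_iff` (under Q3, the instance of Q2 USED at
`min S` is literally `¬ G(min S)`: the recut separates proof TECHNOLOGIES — Q2 is proved uniformly in `μ` by lattice-only
means, nobody has to locate `min S` — not truth values), `uniformGapAbove_descend_of_rayProperty` / `_of_rayDescent`.

DISPROOF USED (`Cruxes/ChiralDescent/Disproof.lean`, cdisprove FINAL, RESISTS; landed `Negative/FlavourGuard` p132010,
`Negative/DataLevelObstruction` p133708, both imported here): §3 `not_isChiralAtZero_of_eventuallyThresholdData` /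
`isChiralAtZero_of_restrict` honoured — the witness is the shift of the hypothesis' own `reg` by the located `μ`, and its
chirality `¬ G(μ)` is DERIVED (Q2 + Q3 make `G(min S)` contradictory), never read off threshold data; §4
`not_keepThresholdReg_of_uniformGap` respected (re-zero at `min S`, not at `M₁`); §2 flavour guard: `0 < N_f` at the attained
infimum, `N_f ∈ {2,3}` inside Q1/Q2 (at `N_f = 0` Q2, Q3 are trivially true and Q1 is `not_qcdOf_zero`-false); §5: the pin
produced is `∀ ε ∃ m > μ·𝟙, ¬ gap ε`, exactly `IsChiralAtZero` of the shift. No `-- Targets` stub of the Disproof is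
instantiated; `ledger negatives --problem QuantumFields` (14958, 9665, 9494, 9599, 9603): none is an instance of W/Q1/Q2/Q3.
Pure logic over `QCDOS.lean` + landed glue; standard axioms; no new physics is proved here.
-/

namespace Summit.QuantumFields.QCD.Cruxes.ChiralDescent.GapUpsetRecut

open Filter
open Literature.MathematicalPhysics.QuantumFieldTheory
open Summit.QuantumFields.QCD.Cruxes.ChiralDescent.InfimumDescent
open Summit.QuantumFields.QCD.Theorems.RobustYangMillsHandover.Negative (tendsto_massIncrement_zero)

variable {Nf : ℕ}

/-! ## §1 Two up-sets — abstract order theory on `Fin N_f → ℝ` (sorry-free) -/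

/-- **E from (Q1, Q2, Q3).**  `P` a per-tuple property (`0 < N_f`), `G` a property of offsets.  If (Q1) `P` everywhere
forces `¬ G` somewhere, (Q2) `P` above `μ` and `G μ` force `G μ'` for some `μ' < μ`, and (Q3) `G μ`, `μ < ν` and `P`
above `ν` force `P` above `ν − δ` for some `δ > 0`, then a non-empty up-set `{μ | P above μ}` contains an offset at which
`G` fails: its attained infimum (bounded branch) or the Q1 offset (unbounded branch). [folklore] -/
theorem exists_above_not_gap_of_gapUpset (hNf : 0 < Nf) (P : (Fin Nf → ℝ) → Prop) (G : ℝ → Prop)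
    (hQ1 : (∀ m, P m) → ∃ μ : ℝ, ¬ G μ)
    (hQ2 : ∀ μ : ℝ, (∀ m : Fin Nf → ℝ, (∀ f, μ < m f) → P m) → G μ → ∃ μ' : ℝ, μ' < μ ∧ G μ')
    (hQ3 : ∀ μ ν : ℝ, μ < ν → G μ → (∀ m : Fin Nf → ℝ, (∀ f, ν < m f) → P m) →
      ∃ δ > (0 : ℝ), ∀ m : Fin Nf → ℝ, (∀ f, ν - δ < m f) → P m)
    {M₁ : ℝ} (hM : ∀ m : Fin Nf → ℝ, (∀ f, M₁ < m f) → P m) :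
    ∃ μ : ℝ, (∀ m : Fin Nf → ℝ, (∀ f, μ < m f) → P m) ∧ ¬ G μ := by
  classical
  set S : Set ℝ := {μ : ℝ | ∀ m : Fin Nf → ℝ, (∀ f, μ < m f) → P m} with hS
  have hne : S.Nonempty := ⟨M₁, hM⟩
  by_cases hbdd : BddBelow S
  · have hinf : sInf S ∈ S := forall_above_csInf hNf P hne hbdd
    refine ⟨sInf S, hinf, fun hG => ?_⟩
    obtain ⟨μ', hμ'lt, hGμ'⟩ := hQ2 _ hinf hG
    obtain ⟨δ, hδ, hB'⟩ := hQ3 μ' (sInf S) hμ'lt hGμ' hinf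
    have hle : sInf S ≤ sInf S - δ := csInf_le hbdd hB'
    linarith
  · have hall : ∀ μ, μ ∈ S := by
      intro μ
      rw [bddBelow_def] at hbdd
      push Not at hbdd
      obtain ⟨y, hyS, hy⟩ := hbdd μ
      exact fun m hm => hyS m fun f => lt_of_le_of_lt hy.le (hm f)
    obtain ⟨μ, hμ⟩ := hQ1 fun m => hall _ m (neg_sum_abs_sub_one_lt m)
    exact ⟨μ, hall μ, hμ⟩

/-- **(Q2 ∧ Q3) ⇒ OPENNESS (the shape of H1 ≡ item 18327, per regularisation).** [folklore] -/
theorem openness_of_gapUpset (P : (Fin Nf → ℝ) → Prop) (G : ℝ → Prop)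
    (hQ2 : ∀ μ : ℝ, (∀ m : Fin Nf → ℝ, (∀ f, μ < m f) → P m) → G μ → ∃ μ' : ℝ, μ' < μ ∧ G μ')
    (hQ3 : ∀ μ ν : ℝ, μ < ν → G μ → (∀ m : Fin Nf → ℝ, (∀ f, ν < m f) → P m) →
      ∃ δ > (0 : ℝ), ∀ m : Fin Nf → ℝ, (∀ f, ν - δ < m f) → P m) :
    ∀ μ : ℝ, (∀ m : Fin Nf → ℝ, (∀ f, μ < m f) → P m) → G μ →
      ∃ δ > (0 : ℝ), ∀ m : Fin Nf → ℝ, (∀ f, μ - δ < m f) → P m := by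
  intro μ hP hG
  obtain ⟨μ', hlt, hG'⟩ := hQ2 μ hP hG
  exact hQ3 μ' μ hlt hG' hP

/-- **OPENNESS (H1) ⇒ Q3** as soon as `G` is an up-set: the construction stub of the recut is WEAKER than the dead stub.
[folklore] -/
theorem bodyIntoGap_of_openness (P : (Fin Nf → ℝ) → Prop) (G : ℝ → Prop)
    (hGmono : ∀ μ μ' : ℝ, μ ≤ μ' → G μ → G μ')
    (hopen : ∀ μ : ℝ, (∀ m : Fin Nf → ℝ, (∀ f, μ < m f) → P m) → G μ →
      ∃ δ > (0 : ℝ), ∀ m : Fin Nf → ℝ, (∀ f, μ - δ < m f) → P m) :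
    ∀ μ ν : ℝ, μ < ν → G μ → (∀ m : Fin Nf → ℝ, (∀ f, ν < m f) → P m) →
      ∃ δ > (0 : ℝ), ∀ m : Fin Nf → ℝ, (∀ f, ν - δ < m f) → P m := by
  intro μ ν hlt hG hP
  exact hopen ν hP (hGmono μ ν hlt.le hG)

/-- A GLOBAL Q3 ("`G μ`, `μ < ν`, `P` above `ν` ⇒ `P` above `μ`") gives the local one with `δ = ν − μ`. [folklore] -/
theorem bodyIntoGap_local_of_global (P : (Fin Nf → ℝ) → Prop) (G : ℝ → Prop)
    (hQ3g : ∀ μ ν : ℝ, μ < ν → G μ → (∀ m : Fin Nf → ℝ, (∀ f, ν < m f) → P m) →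
      ∀ m : Fin Nf → ℝ, (∀ f, μ < m f) → P m) :
    ∀ μ ν : ℝ, μ < ν → G μ → (∀ m : Fin Nf → ℝ, (∀ f, ν < m f) → P m) →
      ∃ δ > (0 : ℝ), ∀ m : Fin Nf → ℝ, (∀ f, ν - δ < m f) → P m := by
  intro μ ν hlt hG hP
  refine ⟨ν - μ, sub_pos.mpr hlt, fun m hm => hQ3g μ ν hlt hG hP m fun f => ?_⟩
  have := hm f
  linarith

/-- **The instance of Q2 that the composition USES is `¬ G(min S)`** (triage r2-1 (s3); the card's objection 11, certified):
under Q3, at an offset `μ` that carries `P` above it and is minimal with that property, "`G μ ⇒ some μ' < μ in G`" is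
equivalent to `¬ G μ`.  So the recut separates proof technologies (a prover of Q2 never sees `S` or `min S`), not truth
values. [folklore] -/
theorem q2_at_min_iff (P : (Fin Nf → ℝ) → Prop) (G : ℝ → Prop)
    (hQ3 : ∀ μ ν : ℝ, μ < ν → G μ → (∀ m : Fin Nf → ℝ, (∀ f, ν < m f) → P m) →
      ∃ δ > (0 : ℝ), ∀ m : Fin Nf → ℝ, (∀ f, ν - δ < m f) → P m)
    {μ : ℝ} (hS : ∀ m : Fin Nf → ℝ, (∀ f, μ < m f) → P m)
    (hmin : ∀ μ'' < μ, ¬ ∀ m : Fin Nf → ℝ, (∀ f, μ'' < m f) → P m) :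
    (G μ → ∃ μ' : ℝ, μ' < μ ∧ G μ') ↔ ¬ G μ := by
  constructor
  · intro h hG
    obtain ⟨μ', hlt, hG'⟩ := h hG
    obtain ⟨δ, hδ, hP⟩ := hQ3 μ' μ hlt hG' hS
    exact hmin (μ - δ) (by linarith) hP
  · exact fun h hG => absurd hG h

/-- **RAY PROPERTY ⇒ THE UNIFORM-GAP UP-SET DESCENDS above a corner pinned at `0`** (the conclusion SHAPE of
`EulerDescent.RayDescent`, stmt-16900; triage r2-1 `uniformGap_below_of_rayDescent`): if for every positive tuple `m`,
every `l ≥ 1` and every rate `Δ`, the rate `Δ` at `l·m` gives every rate `Δ' < Δ/l` at `m`, then ONE rate above `μ > 0`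
gives ONE rate (`ε μ'/(2μ)`) above every `μ' ∈ (0, μ)` — Q2 at positive pinned offsets, body-free. [folklore] -/
theorem uniformGapAbove_descend_of_rayProperty (gap : (Fin Nf → ℝ) → ℝ → Prop)
    (hray : ∀ m : Fin Nf → ℝ, (∀ f, 0 < m f) → ∀ l : ℝ, 1 ≤ l → ∀ Δ : ℝ, 0 < Δ →
      gap (fun f => l * m f) Δ → ∀ Δ' : ℝ, 0 < Δ' → Δ' < Δ / l → gap m Δ')
    {μ μ' : ℝ} (hμ' : 0 < μ') (hlt : μ' < μ)
    (hG : ∃ ε > (0 : ℝ), ∀ m : Fin Nf → ℝ, (∀ f, μ < m f) → gap m ε) :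
    ∃ ε > (0 : ℝ), ∀ m : Fin Nf → ℝ, (∀ f, μ' < m f) → gap m ε := by
  obtain ⟨ε, hε, hg⟩ := hG
  have hμ : 0 < μ := lt_trans hμ' hlt
  have hl : 1 ≤ μ / μ' := (one_le_div hμ').mpr hlt.le
  have hlpos : 0 < μ / μ' := div_pos hμ hμ'
  refine ⟨ε * μ' / (2 * μ), by positivity, fun m hm => ?_⟩
  have hmpos : ∀ f, 0 < m f := fun f => lt_trans hμ' (hm f)
  have hup : gap (fun f => μ / μ' * m f) ε := by
    refine hg _ fun f => ?_
    have h1 : μ / μ' * μ' = μ := div_mul_cancel₀ μ hμ'.ne'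
    have h2 : μ / μ' * μ' < μ / μ' * m f := mul_lt_mul_of_pos_left (hm f) hlpos
    linarith
  refine hray m hmpos (μ / μ') hl ε hε hup _ (by positivity) ?_
  rw [lt_div_iff₀ hlpos]
  have h3 : ε * μ' / (2 * μ) * (μ / μ') = ε / 2 := by
    field_simp
  rw [h3]
  linarith

/-! ## §2 The REGISTERED STUBS — exactly four: W (wall no-go), Q1 (= shared H2), Q2 (new), Q3 (⇐ 16903, ⇐ 18327) -/

/-- **W_lim — THE WALL NO-GO, FULL-SEQUENCE FORM (corner; the REGISTERED wall stub since lead c11's reshape; conjecture class —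
open-problem grade, NOT M–L: see `Theorems/SpectralDefectExtinctionChiralDescentWallLimit.lean`, sizing note).**  For `N_f ∈ {2,3}` and a
mass-scaling regularisation whose critical masses CONVERGE to the wall, `m_crit(k) → −1` (so every fixed renormalised tuple runs ALL its
bare masses `→ −1⁺`, hopping parameter `→ 1/6⁻`, along the whole asymptotically scaling sequence), NO offset `μ` has the body at every
tuple above it: the OS limit of lattice QCD with every Wilson quark in the supercritical window at `m₀ → −1` has trivial flavour-changing
pseudoscalars (decoupling of cutoff-mass quarks; expected mechanism: localisation of the supercritical near-zero modes of `D_W`,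
Golterman–Shamir mobility edge — unproved).  Equivalent to the planner's `lim inf` form W (`WallLimit.wallNoGo_iff_wallLimitNoGo`,
landed): the body at one tuple pins `lim inf m_crit ≥ −1`, a subsequence converges to `−1`, and the body is hereditary to subsequences.
[folklore] -/
theorem stub_wallLimitNoGo : ∀ Nf : ℕ, (Nf = 2 ∨ Nf = 3) → ∀ reg : QCDRegularisation Nf, reg.HasMassScaling →
    Tendsto reg.mcrit atTop (nhds (-1)) → ∀ μ : ℝ,
    ¬ ∀ m : Fin Nf → ℝ, (∀ f, μ < m f) →
      ∃ (z shift : QCDField Nf → ℕ → ℝ) (T : OSData (QCDField Nf) 4),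
        IsQCDAlong (reg.scheme m z shift) T ∧ T.IsNontrivial QCDField.glue ∧ T.IsNonGaussian QCDField.glue ∧
          (∀ f g : Fin Nf, f ≠ g → T.IsNontrivial (QCDField.pseudoRe f g)) ∧
            ∃ Δ > 0, T.HasMassGap Δ ∧ (reg.scheme m z shift).HasLatticeMassGap Δ := by
  sorry

/-- **W — the wall no-go in the planner's `lim inf` form, DERIVED from the registered `stub_wallLimitNoGo`** (sorry-free reduction
`WallLimit.wallNoGo_of_wallLimitNoGo`, landed `--supports` stmt-QuantumFields-17527): for `N_f ∈ {2,3}` and a mass-scaling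
regularisation whose critical masses are FREQUENTLY below every `c > −1`, no offset carries the body. [folklore] -/
theorem stub_wallNoGo : ∀ Nf : ℕ, (Nf = 2 ∨ Nf = 3) → ∀ reg : QCDRegularisation Nf, reg.HasMassScaling →
    (∀ c : ℝ, -1 < c → ∃ᶠ k in atTop, reg.mcrit k < c) → ∀ μ : ℝ,
    ¬ ∀ m : Fin Nf → ℝ, (∀ f, μ < m f) →
      ∃ (z shift : QCDField Nf → ℕ → ℝ) (T : OSData (QCDField Nf) 4),
        IsQCDAlong (reg.scheme m z shift) T ∧ T.IsNontrivial QCDField.glue ∧ T.IsNonGaussian QCDField.glue ∧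
          (∀ f g : Fin Nf, f ≠ g → T.IsNontrivial (QCDField.pseudoRe f g)) ∧
            ∃ Δ > 0, T.HasMassGap Δ ∧ (reg.scheme m z shift).HasLatticeMassGap Δ :=
  WallLimit.wallNoGo_of_wallLimitNoGo stub_wallLimitNoGo

/-- **Q1 — A BODY AT EVERY REAL TUPLE HAS AN OFFSET WITHOUT UNIFORM RATE (verbatim the shared stub H2 of line `Sketch` /
S4 of line `saturated_infimum`; conjecture class, a no-go in disguise).**  Implied by item stmt-18328
`QuarksAsStableAction.ChiralTupleGapless` (landed `chiralPointOfBodyEverywhere_of_chiralTupleGapless`, p139859: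
a body everywhere would gap the gapless tuple), re-exported as `stub_chiralPointOfBodyEverywhere_of_chiralTupleGapless`;
engines: `stub_noAnalyticAnomaly` p134287 / `stub_goldstoneFluxBound` p134184. Used only in the branch `S = ℝ`
(physically empty). [folklore] -/
theorem stub_chiralPointOfBodyEverywhere :
    ∀ Nf : ℕ, (Nf = 2 ∨ Nf = 3) → ∀ reg : QCDRegularisation Nf, reg.HasMassScaling →
      (∀ m : Fin Nf → ℝ,
        ∃ (z shift : QCDField Nf → ℕ → ℝ) (T : OSData (QCDField Nf) 4),
          IsQCDAlong (reg.scheme m z shift) T ∧ T.IsNontrivial QCDField.glue ∧ T.IsNonGaussian QCDField.glue ∧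
            (∀ f g : Fin Nf, f ≠ g → T.IsNontrivial (QCDField.pseudoRe f g)) ∧
              ∃ Δ > 0, T.HasMassGap Δ ∧ (reg.scheme m z shift).HasLatticeMassGap Δ) →
      ∃ μ : ℝ, ∀ ε > (0 : ℝ), ∃ m : Fin Nf → ℝ, (∀ f, μ < m f) ∧ ¬ (reg.scheme m 0 0).HasLatticeMassGap ε := by
  sorry

/-- **Q2 — THE UNIFORM-GAP UP-SET NEVER STARTS AT A BODY OFFSET (the NEW stub; body-free CONCLUSION; interior
regularisations).**  For `N_f ∈ {2,3}`, a mass-scaling `reg` with `m_crit(k) ≥ c > −1` eventually, and an offset `μ`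
above which the body holds: ONE lattice rate `ε` on every tuple above `μ` forces ONE lattice rate on every tuple above
some `μ' < μ`.  Equivalently: the infimum of the uniform-gap up-set `G(reg)`, if attained, is not a body offset — no
`k`-ASYMPTOTIC LATTICE-GAP WALL in the renormalised mass at a body offset.  Physics: a body offset `μ` lies at or above
the chiral offset `μ_χ`; at `μ = μ_χ` the hypothesis `μ ∈ G` fails (Goldstone: rates `→ 0` at the corner, or the 't Hooft
anomaly engine by contradiction), at `μ > μ_χ` the lattice gap of the massive phase extends below `μ` (uniform exponential
clustering is an open condition in the renormalised couplings; above a PINNED corner this is `RayDescent`'s conclusion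
shape, `uniformGapAbove_descend_of_rayDescent`).  The finite-cutoff avatar of a wall (Sharpe–Singleton first-order
scenario, minimal pion mass `m_a ∼ a`) is invisible to the eventually-in-`k` up-set `G`; Q2 is exactly "no wall survives
`k → ∞` at a body offset". [folklore] -/
theorem stub_gapUpsetNoStart : ∀ Nf : ℕ, (Nf = 2 ∨ Nf = 3) → ∀ reg : QCDRegularisation Nf, reg.HasMassScaling →
    (∃ c : ℝ, -1 < c ∧ ∀ᶠ k in atTop, c ≤ reg.mcrit k) → ∀ μ : ℝ,
    (∀ m : Fin Nf → ℝ, (∀ f, μ < m f) →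
      ∃ (z shift : QCDField Nf → ℕ → ℝ) (T : OSData (QCDField Nf) 4),
        IsQCDAlong (reg.scheme m z shift) T ∧ T.IsNontrivial QCDField.glue ∧ T.IsNonGaussian QCDField.glue ∧
          (∀ f g : Fin Nf, f ≠ g → T.IsNontrivial (QCDField.pseudoRe f g)) ∧
            ∃ Δ > 0, T.HasMassGap Δ ∧ (reg.scheme m z shift).HasLatticeMassGap Δ) →
    (∃ ε > (0 : ℝ), ∀ m : Fin Nf → ℝ, (∀ f, μ < m f) → (reg.scheme m 0 0).HasLatticeMassGap ε) →
    ∃ μ' : ℝ, μ' < μ ∧ ∃ ε > (0 : ℝ), ∀ m : Fin Nf → ℝ, (∀ f, μ' < m f) → (reg.scheme m 0 0).HasLatticeMassGap ε := by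
  sorry

/-- **Q3 — THE BODY FOLLOWS THE GAP (local form; interior regularisations; the hardest stub by size — a light-quark
construction WITH its infrared input).**  For `N_f ∈ {2,3}` and a mass-scaling `reg` with `m_crit(k) ≥ c > −1` eventually:
if ONE lattice rate holds on every tuple above `μ`, `μ < ν`, and the body holds above `ν`, then the body holds above
`ν − δ` for some `δ > 0` — light-quark continuation INTO CERTIFIED-GAPPED territory (fermionic UV stability, E0′ bounds,
mass-equicontinuity with the IR modulus supplied on both sides of `ν`, identification of the full-sequence limit by
Vitali/analyticity in the mass — bricks `StubMontelBoundedDisc` p136051, `StubVitaliOfMontel` p136087,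
`StubTorusFunctionalPolynomialInMass` p136485).  STRICTLY WEAKER than item 18327 `MassContinuation`
(`stub_bodyIntoGap_of_massContinuation`) and an INSTANCE of item 16903 `EulerDescent.RetypedContinuumComplement` applied to
the `m_crit`-shift of `reg` by `μ` (`stub_bodyIntoGap_of_retypedContinuumComplement`) — both sorry-free below. [folklore] -/
theorem stub_bodyIntoGap : ∀ Nf : ℕ, (Nf = 2 ∨ Nf = 3) → ∀ reg : QCDRegularisation Nf, reg.HasMassScaling →
    (∃ c : ℝ, -1 < c ∧ ∀ᶠ k in atTop, c ≤ reg.mcrit k) → ∀ μ ν : ℝ, μ < ν →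
    (∃ ε > (0 : ℝ), ∀ m : Fin Nf → ℝ, (∀ f, μ < m f) → (reg.scheme m 0 0).HasLatticeMassGap ε) →
    (∀ m : Fin Nf → ℝ, (∀ f, ν < m f) →
      ∃ (z shift : QCDField Nf → ℕ → ℝ) (T : OSData (QCDField Nf) 4),
        IsQCDAlong (reg.scheme m z shift) T ∧ T.IsNontrivial QCDField.glue ∧ T.IsNonGaussian QCDField.glue ∧
          (∀ f g : Fin Nf, f ≠ g → T.IsNontrivial (QCDField.pseudoRe f g)) ∧
            ∃ Δ > 0, T.HasMassGap Δ ∧ (reg.scheme m z shift).HasLatticeMassGap Δ) →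
    ∃ δ > (0 : ℝ), ∀ m : Fin Nf → ℝ, (∀ f, ν - δ < m f) →
      ∃ (z shift : QCDField Nf → ℕ → ℝ) (T : OSData (QCDField Nf) 4),
        IsQCDAlong (reg.scheme m z shift) T ∧ T.IsNontrivial QCDField.glue ∧ T.IsNonGaussian QCDField.glue ∧
          (∀ f g : Fin Nf, f ≠ g → T.IsNontrivial (QCDField.pseudoRe f g)) ∧
            ∃ Δ > 0, T.HasMassGap Δ ∧ (reg.scheme m z shift).HasLatticeMassGap Δ := by
  sorry

/-! ## §3 Sorry-free bookkeeping -/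

/-- `N_f ∈ {2,3}` is positive. [folklore] -/
theorem nf_pos (hNf : Nf = 2 ∨ Nf = 3) : 0 < Nf := by
  rcases hNf with rfl | rfl <;> norm_num

/-- `N_f ∈ {2,3}` is below the asymptotic-freedom bound. [folklore] -/
theorem nf_le_sixteen (hNf : Nf = 2 ∨ Nf = 3) : Nf ≤ 16 := by
  rcases hNf with rfl | rfl <;> norm_num

/-- The uniform-gap up-set is monotone in the offset. [folklore] -/
theorem uniformGapAbove_mono (reg : QCDRegularisation Nf) {μ μ' : ℝ} (hle : μ ≤ μ')
    (h : ∃ ε > (0 : ℝ), ∀ m : Fin Nf → ℝ, (∀ f, μ < m f) → (reg.scheme m 0 0).HasLatticeMassGap ε) :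
    ∃ ε > (0 : ℝ), ∀ m : Fin Nf → ℝ, (∀ f, μ' < m f) → (reg.scheme m 0 0).HasLatticeMassGap ε := by
  obtain ⟨ε, hε, hg⟩ := h
  exact ⟨ε, hε, fun m hm => hg m fun f => lt_of_le_of_lt hle (hm f)⟩

/-- **Interior regularisations are interior at EVERY renormalised offset**: if `m_crit(k) ≥ c > −1` eventually and `reg`
has mass scaling (`a_k μ / Z_m(k) → 0`, `tendsto_massIncrement_zero`), then `−1 < m_crit(k) + a_k μ / Z_m(k)` eventually —
the branch hypothesis of stmt-16903 for the `m_crit`-shift of `reg` by `μ`. [folklore] -/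
theorem eventually_neg_one_lt_mcrit_shift (hNf : Nf ≤ 16) (reg : QCDRegularisation Nf) (hMS : reg.HasMassScaling)
    (hint : ∃ c : ℝ, -1 < c ∧ ∀ᶠ k in atTop, c ≤ reg.mcrit k) (μ : ℝ) :
    ∀ᶠ k in atTop, (-1 : ℝ) < reg.mcrit k + reg.a k * μ / reg.Zm k := by
  obtain ⟨c, hc, hev⟩ := hint
  have h0 := tendsto_massIncrement_zero hNf reg hMS μ
  have hneg : -((c + 1) / 2) < (0 : ℝ) := by linarith
  filter_upwards [hev, (tendsto_order.mp h0).1 (-((c + 1) / 2)) hneg] with k hk hk'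
  linarith

/-- The `m_crit`-shift of `reg` by `μ` runs at `m` the scheme of `reg` at `μ + m` (same `β, L, a`). [folklore] -/
theorem shift_scheme_eq (reg : QCDRegularisation Nf) (μ : ℝ) (m : Fin Nf → ℝ) (z shift : QCDField Nf → ℕ → ℝ) :
    ({ reg with mcrit := fun k => reg.mcrit k + reg.a k * μ / reg.Zm k } : QCDRegularisation Nf).scheme m z shift
      = reg.scheme (fun f => μ + m f) z shift := by
  simp only [QCDRegularisation.scheme, QCDScheme.mk.injEq, true_and, and_true]
  funext f k
  ring

/-! ## §4 Certified adapters — how each stub lands on EXISTING ledger items (CONDITIONAL theorems, sorry-free) -/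

/-- **Q1 ⇐ item stmt-18328 `QuarksAsStableAction.ChiralTupleGapless`** (landed p139859, re-exported in this line's
vocabulary). [folklore] -/
theorem stub_chiralPointOfBodyEverywhere_of_chiralTupleGapless
    (h18328 : Theses.QuarksAsStableAction.ChiralTupleGapless) :
    ∀ Nf : ℕ, (Nf = 2 ∨ Nf = 3) → ∀ reg : QCDRegularisation Nf, reg.HasMassScaling →
      (∀ m : Fin Nf → ℝ,
        ∃ (z shift : QCDField Nf → ℕ → ℝ) (T : OSData (QCDField Nf) 4),
          IsQCDAlong (reg.scheme m z shift) T ∧ T.IsNontrivial QCDField.glue ∧ T.IsNonGaussian QCDField.glue ∧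
            (∀ f g : Fin Nf, f ≠ g → T.IsNontrivial (QCDField.pseudoRe f g)) ∧
              ∃ Δ > 0, T.HasMassGap Δ ∧ (reg.scheme m z shift).HasLatticeMassGap Δ) →
      ∃ μ : ℝ, ∀ ε > (0 : ℝ), ∃ m : Fin Nf → ℝ, (∀ f, μ < m f) ∧ ¬ (reg.scheme m 0 0).HasLatticeMassGap ε :=
  chiralPointOfBodyEverywhere_of_chiralTupleGapless h18328

/-- **Q3 ⇐ item stmt-18327 `QuarksAsStableAction.MassContinuation` (the dead stub H1 of line `Sketch`)** — so the
construction stub of the recut is WEAKER than what killed `Sketch`; the extra strength of the recut sits in the body-free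
Q2. (The interior hypothesis is not even used.) [folklore] -/
theorem stub_bodyIntoGap_of_massContinuation (h18327 : Theses.QuarksAsStableAction.MassContinuation) :
    ∀ Nf : ℕ, (Nf = 2 ∨ Nf = 3) → ∀ reg : QCDRegularisation Nf, reg.HasMassScaling →
    (∃ c : ℝ, -1 < c ∧ ∀ᶠ k in atTop, c ≤ reg.mcrit k) → ∀ μ ν : ℝ, μ < ν →
    (∃ ε > (0 : ℝ), ∀ m : Fin Nf → ℝ, (∀ f, μ < m f) → (reg.scheme m 0 0).HasLatticeMassGap ε) →
    (∀ m : Fin Nf → ℝ, (∀ f, ν < m f) →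
      ∃ (z shift : QCDField Nf → ℕ → ℝ) (T : OSData (QCDField Nf) 4),
        IsQCDAlong (reg.scheme m z shift) T ∧ T.IsNontrivial QCDField.glue ∧ T.IsNonGaussian QCDField.glue ∧
          (∀ f g : Fin Nf, f ≠ g → T.IsNontrivial (QCDField.pseudoRe f g)) ∧
            ∃ Δ > 0, T.HasMassGap Δ ∧ (reg.scheme m z shift).HasLatticeMassGap Δ) →
    ∃ δ > (0 : ℝ), ∀ m : Fin Nf → ℝ, (∀ f, ν - δ < m f) →
      ∃ (z shift : QCDField Nf → ℕ → ℝ) (T : OSData (QCDField Nf) 4),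
        IsQCDAlong (reg.scheme m z shift) T ∧ T.IsNontrivial QCDField.glue ∧ T.IsNonGaussian QCDField.glue ∧
          (∀ f g : Fin Nf, f ≠ g → T.IsNontrivial (QCDField.pseudoRe f g)) ∧
            ∃ Δ > 0, T.HasMassGap Δ ∧ (reg.scheme m z shift).HasLatticeMassGap Δ := by
  unfold Theses.QuarksAsStableAction.MassContinuation at h18327
  intro Nf hNf reg hMS _hint μ ν hlt hG hP
  obtain ⟨ε, hε, hgap⟩ := uniformGapAbove_mono reg hlt.le hG
  exact h18327 Nf hNf reg ν ε hMS hε hP hgap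

/-- **GLOBAL Q3 on interior regularisations from item stmt-16903 `EulerDescent.RetypedContinuumComplement`.**  For
`N_f ∈ {2,3}`, an interior mass-scaling `reg`, `μ < ν`, ONE lattice rate above `μ` and the body above `ν`: the body holds
at EVERY tuple above `μ`.  Proof: apply 16903 to the `m_crit`-shift of `reg` by `μ` — its asymptotic scaling is read off
any body tuple, its branch hypothesis is `eventually_neg_one_lt_mcrit_shift`, its heavy body (threshold `ν − μ + 1`) is the
body above `ν`, its per-tuple gaps at positive tuples are the ONE rate on the orthant above `μ` (16903 asks less: a
tuple-dependent `Δ(m) > 0`). [folklore] -/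
theorem bodyAbove_of_retypedContinuumComplement (h16903 : Theses.EulerDescent.RetypedContinuumComplement)
    (hNf : Nf = 2 ∨ Nf = 3) (reg : QCDRegularisation Nf) (hMS : reg.HasMassScaling)
    (hint : ∃ c : ℝ, -1 < c ∧ ∀ᶠ k in atTop, c ≤ reg.mcrit k) {μ ν : ℝ} (hlt : μ < ν)
    (hG : ∃ ε > (0 : ℝ), ∀ m : Fin Nf → ℝ, (∀ f, μ < m f) → (reg.scheme m 0 0).HasLatticeMassGap ε)
    (hP : ∀ m : Fin Nf → ℝ, (∀ f, ν < m f) →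
      ∃ (z shift : QCDField Nf → ℕ → ℝ) (T : OSData (QCDField Nf) 4),
        IsQCDAlong (reg.scheme m z shift) T ∧ T.IsNontrivial QCDField.glue ∧ T.IsNonGaussian QCDField.glue ∧
          (∀ f g : Fin Nf, f ≠ g → T.IsNontrivial (QCDField.pseudoRe f g)) ∧
            ∃ Δ > 0, T.HasMassGap Δ ∧ (reg.scheme m z shift).HasLatticeMassGap Δ) :
    ∀ m : Fin Nf → ℝ, (∀ f, μ < m f) →
      ∃ (z shift : QCDField Nf → ℕ → ℝ) (T : OSData (QCDField Nf) 4),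
        IsQCDAlong (reg.scheme m z shift) T ∧ T.IsNontrivial QCDField.glue ∧ T.IsNonGaussian QCDField.glue ∧
          (∀ f g : Fin Nf, f ≠ g → T.IsNontrivial (QCDField.pseudoRe f g)) ∧
            ∃ Δ > 0, T.HasMassGap Δ ∧ (reg.scheme m z shift).HasLatticeMassGap Δ := by
  unfold Theses.EulerDescent.RetypedContinuumComplement at h16903
  -- the shifted regularisation
  set reg' : QCDRegularisation Nf := { reg with mcrit := fun k => reg.mcrit k + reg.a k * μ / reg.Zm k } with hreg'
  have hs : ∀ (m : Fin Nf → ℝ) (z shift : QCDField Nf → ℕ → ℝ),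
      reg'.scheme m z shift = reg.scheme (fun f => μ + m f) z shift := fun m z shift => shift_scheme_eq reg μ m z shift
  have hMS' : reg'.HasMassScaling := hMS
  -- asymptotic scaling from the body at the tuple ν + 1
  obtain ⟨z₀, s₀, T₀, hQ₀, -⟩ := hP (fun _ => ν + 1) (fun _ => by linarith)
  have hAS' : (reg'.scheme 0 0 0).HasAsymptoticScaling := by
    obtain ⟨hAS, -⟩ := hQ₀
    exact hAS
  -- the branch hypothesis of the shift: interior at the offset μ
  have hint' : ∀ᶠ k in atTop, (-1 : ℝ) < reg'.mcrit k :=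
    eventually_neg_one_lt_mcrit_shift (nf_le_sixteen hNf) reg hMS hint μ
  -- heavy body of the shift: threshold ν − μ + 1 > 0
  have hheavy : ∃ Mh : ℝ, 0 < Mh ∧ ∀ m : Fin Nf → ℝ, (∀ f, Mh ≤ m f) →
      ∃ (z shift : QCDField Nf → ℕ → ℝ) (T : OSData (QCDField Nf) 4),
        IsQCDAlong (reg'.scheme m z shift) T ∧ T.IsNontrivial QCDField.glue ∧ T.IsNonGaussian QCDField.glue ∧
          (∀ f g : Fin Nf, f ≠ g → T.IsNontrivial (QCDField.pseudoRe f g)) ∧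
            ∃ Δ > 0, T.HasMassGap Δ ∧ (reg'.scheme m z shift).HasLatticeMassGap Δ := by
    refine ⟨ν - μ + 1, by linarith, fun m hm => ?_⟩
    obtain ⟨z, s, T, hT⟩ := hP (fun f => μ + m f) (fun f => by have := hm f; linarith)
    exact ⟨z, s, T, by rw [hs]; exact hT⟩
  -- per-tuple gaps of the shift at positive tuples: the one rate above μ
  have hgaps : ∀ m : Fin Nf → ℝ, (∀ f, 0 < m f) → ∃ Δ > 0, (reg'.scheme m 0 0).HasLatticeMassGap Δ := by
    intro m hm
    obtain ⟨ε, hε, hg⟩ := hG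
    refine ⟨ε, hε, ?_⟩
    rw [hs]
    exact hg _ fun f => by have := hm f; linarith
  -- apply 16903 and shift back
  intro m hm
  have hpos : ∀ f, 0 < m f - μ := fun f => sub_pos.mpr (hm f)
  obtain ⟨z, s, T, hT⟩ := h16903 Nf hNf reg' hMS' hAS' hint' hheavy hgaps (fun f => m f - μ) hpos
  refine ⟨z, s, T, ?_⟩
  have heq : (fun f => μ + (m f - μ)) = m := funext fun f => by ring
  rw [hs, heq] at hT
  exact hT

/-- **Q3 ⇐ item stmt-16903 `EulerDescent.RetypedContinuumComplement`, LITERALLY** (local form with `δ = ν − μ`): the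
construction half of the recut is an instance of a STAFFED crux of route EulerDescent whose infrared input the up-set `G`
supplies; its open inputs are fermionic UV stability (E0′ off-diagonal) and E1/identification of the limit, never IR.
[folklore] -/
theorem stub_bodyIntoGap_of_retypedContinuumComplement (h16903 : Theses.EulerDescent.RetypedContinuumComplement) :
    ∀ Nf : ℕ, (Nf = 2 ∨ Nf = 3) → ∀ reg : QCDRegularisation Nf, reg.HasMassScaling →
    (∃ c : ℝ, -1 < c ∧ ∀ᶠ k in atTop, c ≤ reg.mcrit k) → ∀ μ ν : ℝ, μ < ν →
    (∃ ε > (0 : ℝ), ∀ m : Fin Nf → ℝ, (∀ f, μ < m f) → (reg.scheme m 0 0).HasLatticeMassGap ε) →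
    (∀ m : Fin Nf → ℝ, (∀ f, ν < m f) →
      ∃ (z shift : QCDField Nf → ℕ → ℝ) (T : OSData (QCDField Nf) 4),
        IsQCDAlong (reg.scheme m z shift) T ∧ T.IsNontrivial QCDField.glue ∧ T.IsNonGaussian QCDField.glue ∧
          (∀ f g : Fin Nf, f ≠ g → T.IsNontrivial (QCDField.pseudoRe f g)) ∧
            ∃ Δ > 0, T.HasMassGap Δ ∧ (reg.scheme m z shift).HasLatticeMassGap Δ) →
    ∃ δ > (0 : ℝ), ∀ m : Fin Nf → ℝ, (∀ f, ν - δ < m f) →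
      ∃ (z shift : QCDField Nf → ℕ → ℝ) (T : OSData (QCDField Nf) 4),
        IsQCDAlong (reg.scheme m z shift) T ∧ T.IsNontrivial QCDField.glue ∧ T.IsNonGaussian QCDField.glue ∧
          (∀ f g : Fin Nf, f ≠ g → T.IsNontrivial (QCDField.pseudoRe f g)) ∧
            ∃ Δ > 0, T.HasMassGap Δ ∧ (reg.scheme m z shift).HasLatticeMassGap Δ := by
  intro Nf hNf reg hMS hint μ ν hlt hG hP
  refine ⟨ν - μ, sub_pos.mpr hlt, fun m hm => ?_⟩
  refine bodyAbove_of_retypedContinuumComplement h16903 hNf reg hMS hint hlt hG hP m fun f => ?_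
  have := hm f
  linarith

/-- **Q2 above a PINNED corner ⇐ item stmt-16900 `EulerDescent.RayDescent`, literally** (triage r2-1): along a
regularisation satisfying the hypotheses of `RayDescent` (intrinsic corner `mc(k)` eventually, pin
`(m_crit − mc)·Z_m/a → 0`, mass scaling, asymptotic scaling, `m_crit > −1` eventually), ONE rate above `μ > 0` gives ONE
rate above every `μ' ∈ (0, μ)` — body-free.  So at PCAC-massive offsets of a pinned regularisation Q2 is the conclusion
shape of a staffed crux; its residual content is (i) the chiral offset itself (`μ' ≤ 0`: there `G` must FAIL — the
engines / `EulerDescent.ChiralCornerSoftness` 16902) and (ii) un-pinned regularisations. [folklore] -/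
theorem uniformGapAbove_descend_of_rayDescent (h16900 : Theses.EulerDescent.RayDescent)
    (reg : QCDRegularisation Nf) (mc : ℕ → ℝ)
    (hcorner : ∀ᶠ k in atTop, IsLUB {μ : ℝ | ¬ (∀ (R R' : ℕ) (A : QCDLatticeObservable Nf R)
      (B : QCDLatticeObservable Nf R'), ∃ (C δ : ℝ) (S₀ : ℕ), 0 < δ ∧ ∀ S : ℕ, S₀ ≤ S → ∀ n : ℕ, n ≤ S →
        ‖qcdLatticeConnectedCorr (reg.β k) (2 * S + 1) (fun _ : Fin Nf => μ) A B n‖ ≤ C * Real.exp (-(δ * n)))} (mc k))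
    (hpin : Tendsto (fun k => (reg.mcrit k - mc k) * reg.Zm k / reg.a k) atTop (nhds 0))
    (hMS : reg.HasMassScaling) (hAS : (reg.scheme 0 0 0).HasAsymptoticScaling)
    (hbranch : ∀ᶠ k in atTop, (-1 : ℝ) < reg.mcrit k)
    {μ μ' : ℝ} (hμ' : 0 < μ') (hlt : μ' < μ)
    (hG : ∃ ε > (0 : ℝ), ∀ m : Fin Nf → ℝ, (∀ f, μ < m f) → (reg.scheme m 0 0).HasLatticeMassGap ε) :
    ∃ ε > (0 : ℝ), ∀ m : Fin Nf → ℝ, (∀ f, μ' < m f) → (reg.scheme m 0 0).HasLatticeMassGap ε := by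
  unfold Theses.EulerDescent.RayDescent at h16900
  exact uniformGapAbove_descend_of_rayProperty (fun m Δ => (reg.scheme m 0 0).HasLatticeMassGap Δ)
    (h16900 Nf reg mc hcorner hpin hMS hAS hbranch) hμ' hlt hG

/-- **(Q2 ∧ Q3) ⇒ item 18327 RESTRICTED TO INTERIOR REGULARISATIONS** (mass continuation below a uniformly gapped body
offset): the pair of new stubs is logically STRONGER than the interior form of the dead stub H1 — by exactly the
body-free content of Q2 away from `min S` (declared; the card's Transfer paragraph). [folklore] -/
theorem interiorMassContinuation_of_stubs
    (hQ2 : ∀ Nf : ℕ, (Nf = 2 ∨ Nf = 3) → ∀ reg : QCDRegularisation Nf, reg.HasMassScaling →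
      (∃ c : ℝ, -1 < c ∧ ∀ᶠ k in atTop, c ≤ reg.mcrit k) → ∀ μ : ℝ,
      (∀ m : Fin Nf → ℝ, (∀ f, μ < m f) →
        ∃ (z shift : QCDField Nf → ℕ → ℝ) (T : OSData (QCDField Nf) 4),
          IsQCDAlong (reg.scheme m z shift) T ∧ T.IsNontrivial QCDField.glue ∧ T.IsNonGaussian QCDField.glue ∧
            (∀ f g : Fin Nf, f ≠ g → T.IsNontrivial (QCDField.pseudoRe f g)) ∧
              ∃ Δ > 0, T.HasMassGap Δ ∧ (reg.scheme m z shift).HasLatticeMassGap Δ) →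
      (∃ ε > (0 : ℝ), ∀ m : Fin Nf → ℝ, (∀ f, μ < m f) → (reg.scheme m 0 0).HasLatticeMassGap ε) →
      ∃ μ' : ℝ, μ' < μ ∧ ∃ ε > (0 : ℝ), ∀ m : Fin Nf → ℝ, (∀ f, μ' < m f) → (reg.scheme m 0 0).HasLatticeMassGap ε)
    (hQ3 : ∀ Nf : ℕ, (Nf = 2 ∨ Nf = 3) → ∀ reg : QCDRegularisation Nf, reg.HasMassScaling →
      (∃ c : ℝ, -1 < c ∧ ∀ᶠ k in atTop, c ≤ reg.mcrit k) → ∀ μ ν : ℝ, μ < ν →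
      (∃ ε > (0 : ℝ), ∀ m : Fin Nf → ℝ, (∀ f, μ < m f) → (reg.scheme m 0 0).HasLatticeMassGap ε) →
      (∀ m : Fin Nf → ℝ, (∀ f, ν < m f) →
        ∃ (z shift : QCDField Nf → ℕ → ℝ) (T : OSData (QCDField Nf) 4),
          IsQCDAlong (reg.scheme m z shift) T ∧ T.IsNontrivial QCDField.glue ∧ T.IsNonGaussian QCDField.glue ∧
            (∀ f g : Fin Nf, f ≠ g → T.IsNontrivial (QCDField.pseudoRe f g)) ∧
              ∃ Δ > 0, T.HasMassGap Δ ∧ (reg.scheme m z shift).HasLatticeMassGap Δ) →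
      ∃ δ > (0 : ℝ), ∀ m : Fin Nf → ℝ, (∀ f, ν - δ < m f) →
        ∃ (z shift : QCDField Nf → ℕ → ℝ) (T : OSData (QCDField Nf) 4),
          IsQCDAlong (reg.scheme m z shift) T ∧ T.IsNontrivial QCDField.glue ∧ T.IsNonGaussian QCDField.glue ∧
            (∀ f g : Fin Nf, f ≠ g → T.IsNontrivial (QCDField.pseudoRe f g)) ∧
              ∃ Δ > 0, T.HasMassGap Δ ∧ (reg.scheme m z shift).HasLatticeMassGap Δ) :
    ∀ Nf : ℕ, (Nf = 2 ∨ Nf = 3) → ∀ (reg : QCDRegularisation Nf) (M ε : ℝ), reg.HasMassScaling →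
      (∃ c : ℝ, -1 < c ∧ ∀ᶠ k in atTop, c ≤ reg.mcrit k) → 0 < ε →
      (∀ m : Fin Nf → ℝ, (∀ f, M < m f) →
        ∃ (z shift : QCDField Nf → ℕ → ℝ) (T : OSData (QCDField Nf) 4),
          IsQCDAlong (reg.scheme m z shift) T ∧ T.IsNontrivial QCDField.glue ∧ T.IsNonGaussian QCDField.glue ∧
            (∀ f g : Fin Nf, f ≠ g → T.IsNontrivial (QCDField.pseudoRe f g)) ∧
              ∃ Δ > 0, T.HasMassGap Δ ∧ (reg.scheme m z shift).HasLatticeMassGap Δ) →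
      (∀ m : Fin Nf → ℝ, (∀ f, M < m f) → (reg.scheme m 0 0).HasLatticeMassGap ε) →
      ∃ δ > (0 : ℝ), ∀ m : Fin Nf → ℝ, (∀ f, M - δ < m f) →
        ∃ (z shift : QCDField Nf → ℕ → ℝ) (T : OSData (QCDField Nf) 4),
          IsQCDAlong (reg.scheme m z shift) T ∧ T.IsNontrivial QCDField.glue ∧ T.IsNonGaussian QCDField.glue ∧
            (∀ f g : Fin Nf, f ≠ g → T.IsNontrivial (QCDField.pseudoRe f g)) ∧
              ∃ Δ > 0, T.HasMassGap Δ ∧ (reg.scheme m z shift).HasLatticeMassGap Δ := by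
  intro Nf hNf reg M ε hMS hint hε hB hgap
  exact openness_of_gapUpset
    (fun m => ∃ (z shift : QCDField Nf → ℕ → ℝ) (T : OSData (QCDField Nf) 4),
      IsQCDAlong (reg.scheme m z shift) T ∧ T.IsNontrivial QCDField.glue ∧ T.IsNonGaussian QCDField.glue ∧
        (∀ f g : Fin Nf, f ≠ g → T.IsNontrivial (QCDField.pseudoRe f g)) ∧
          ∃ Δ > 0, T.HasMassGap Δ ∧ (reg.scheme m z shift).HasLatticeMassGap Δ)
    (fun μ => ∃ ε > (0 : ℝ), ∀ m : Fin Nf → ℝ, (∀ f, μ < m f) → (reg.scheme m 0 0).HasLatticeMassGap ε)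
    (hQ2 Nf hNf reg hMS hint) (hQ3 Nf hNf reg hMS hint) M hB ⟨ε, hε, hgap⟩

/-! ## §5 The crux BY NAME -/

/-- **E for an interior threshold regularisation from its instances of (Q1, Q2, Q3)**: an offset carrying the body with
NO uniform rate above it. [folklore] -/
theorem chiralPointOfThreshold_of_gapUpset (hNf : 0 < Nf) (reg : QCDRegularisation Nf)
    (hQ1 : (∀ m : Fin Nf → ℝ,
        ∃ (z shift : QCDField Nf → ℕ → ℝ) (T : OSData (QCDField Nf) 4),
          IsQCDAlong (reg.scheme m z shift) T ∧ T.IsNontrivial QCDField.glue ∧ T.IsNonGaussian QCDField.glue ∧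
            (∀ f g : Fin Nf, f ≠ g → T.IsNontrivial (QCDField.pseudoRe f g)) ∧
              ∃ Δ > 0, T.HasMassGap Δ ∧ (reg.scheme m z shift).HasLatticeMassGap Δ) →
        ∃ μ : ℝ, ∀ ε > (0 : ℝ), ∃ m : Fin Nf → ℝ, (∀ f, μ < m f) ∧ ¬ (reg.scheme m 0 0).HasLatticeMassGap ε)
    (hQ2 : ∀ μ : ℝ,
      (∀ m : Fin Nf → ℝ, (∀ f, μ < m f) →
        ∃ (z shift : QCDField Nf → ℕ → ℝ) (T : OSData (QCDField Nf) 4),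
          IsQCDAlong (reg.scheme m z shift) T ∧ T.IsNontrivial QCDField.glue ∧ T.IsNonGaussian QCDField.glue ∧
            (∀ f g : Fin Nf, f ≠ g → T.IsNontrivial (QCDField.pseudoRe f g)) ∧
              ∃ Δ > 0, T.HasMassGap Δ ∧ (reg.scheme m z shift).HasLatticeMassGap Δ) →
      (∃ ε > (0 : ℝ), ∀ m : Fin Nf → ℝ, (∀ f, μ < m f) → (reg.scheme m 0 0).HasLatticeMassGap ε) →
      ∃ μ' : ℝ, μ' < μ ∧ ∃ ε > (0 : ℝ), ∀ m : Fin Nf → ℝ, (∀ f, μ' < m f) → (reg.scheme m 0 0).HasLatticeMassGap ε)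
    (hQ3 : ∀ μ ν : ℝ, μ < ν →
      (∃ ε > (0 : ℝ), ∀ m : Fin Nf → ℝ, (∀ f, μ < m f) → (reg.scheme m 0 0).HasLatticeMassGap ε) →
      (∀ m : Fin Nf → ℝ, (∀ f, ν < m f) →
        ∃ (z shift : QCDField Nf → ℕ → ℝ) (T : OSData (QCDField Nf) 4),
          IsQCDAlong (reg.scheme m z shift) T ∧ T.IsNontrivial QCDField.glue ∧ T.IsNonGaussian QCDField.glue ∧
            (∀ f g : Fin Nf, f ≠ g → T.IsNontrivial (QCDField.pseudoRe f g)) ∧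
              ∃ Δ > 0, T.HasMassGap Δ ∧ (reg.scheme m z shift).HasLatticeMassGap Δ) →
      ∃ δ > (0 : ℝ), ∀ m : Fin Nf → ℝ, (∀ f, ν - δ < m f) →
        ∃ (z shift : QCDField Nf → ℕ → ℝ) (T : OSData (QCDField Nf) 4),
          IsQCDAlong (reg.scheme m z shift) T ∧ T.IsNontrivial QCDField.glue ∧ T.IsNonGaussian QCDField.glue ∧
            (∀ f g : Fin Nf, f ≠ g → T.IsNontrivial (QCDField.pseudoRe f g)) ∧
              ∃ Δ > 0, T.HasMassGap Δ ∧ (reg.scheme m z shift).HasLatticeMassGap Δ)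
    {M₁ : ℝ}
    (hbody : ∀ m : Fin Nf → ℝ, (∀ f, M₁ < m f) →
      ∃ (z shift : QCDField Nf → ℕ → ℝ) (T : OSData (QCDField Nf) 4),
        IsQCDAlong (reg.scheme m z shift) T ∧ T.IsNontrivial QCDField.glue ∧ T.IsNonGaussian QCDField.glue ∧
          (∀ f g : Fin Nf, f ≠ g → T.IsNontrivial (QCDField.pseudoRe f g)) ∧
            ∃ Δ > 0, T.HasMassGap Δ ∧ (reg.scheme m z shift).HasLatticeMassGap Δ) :
    ∃ μ : ℝ, (∀ m : Fin Nf → ℝ, (∀ f, μ < m f) →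
        ∃ (z shift : QCDField Nf → ℕ → ℝ) (T : OSData (QCDField Nf) 4),
          IsQCDAlong (reg.scheme m z shift) T ∧ T.IsNontrivial QCDField.glue ∧ T.IsNonGaussian QCDField.glue ∧
            (∀ f g : Fin Nf, f ≠ g → T.IsNontrivial (QCDField.pseudoRe f g)) ∧
              ∃ Δ > 0, T.HasMassGap Δ ∧ (reg.scheme m z shift).HasLatticeMassGap Δ) ∧
      ∀ ε > (0 : ℝ), ∃ m : Fin Nf → ℝ, (∀ f, μ < m f) ∧ ¬ (reg.scheme m 0 0).HasLatticeMassGap ε := by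
  obtain ⟨μ, hB, hG⟩ := exists_above_not_gap_of_gapUpset hNf
    (fun m => ∃ (z shift : QCDField Nf → ℕ → ℝ) (T : OSData (QCDField Nf) 4),
      IsQCDAlong (reg.scheme m z shift) T ∧ T.IsNontrivial QCDField.glue ∧ T.IsNonGaussian QCDField.glue ∧
        (∀ f g : Fin Nf, f ≠ g → T.IsNontrivial (QCDField.pseudoRe f g)) ∧
          ∃ Δ > 0, T.HasMassGap Δ ∧ (reg.scheme m z shift).HasLatticeMassGap Δ)
    (fun μ => ∃ ε > (0 : ℝ), ∀ m : Fin Nf → ℝ, (∀ f, μ < m f) → (reg.scheme m 0 0).HasLatticeMassGap ε)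
    (fun hall => by
      obtain ⟨μ, hμ⟩ := hQ1 hall
      refine ⟨μ, ?_⟩
      rintro ⟨ε, hε, hgap⟩
      obtain ⟨m, hm, hng⟩ := hμ ε hε
      exact hng (hgap m hm))
    (fun μ hP hG => hQ2 μ hP hG)
    (fun μ ν hlt hG hP => hQ3 μ ν hlt hG hP)
    hbody
  refine ⟨μ, hB, fun ε hε => ?_⟩
  by_contra hcon
  push Not at hcon
  exact hG ⟨ε, hε, fun m hm => hcon m hm⟩

/-- **The crux from the four stub STATEMENTS (kernel-checked composition, sorry-free).**  Threshold `reg` with body above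
`M₁`: either `reg` is interior — then (Q1, Q2, Q3) locate an offset `μ` carrying the body with no uniform rate above it
(`chiralPointOfThreshold_of_gapUpset`) and the `m_crit`-shift of `reg` by `μ` witnesses `QCDOf N_f`
(`qcdOf_of_bodyAbove_of_noUniformGapAbove`, p134498) — or its critical masses dip below every `c > −1` frequently, and W
denies the threshold body. [folklore] -/
theorem ChiralDescent_of_stubs
    (hW : ∀ Nf : ℕ, (Nf = 2 ∨ Nf = 3) → ∀ reg : QCDRegularisation Nf, reg.HasMassScaling →
      (∀ c : ℝ, -1 < c → ∃ᶠ k in atTop, reg.mcrit k < c) → ∀ μ : ℝ,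
      ¬ ∀ m : Fin Nf → ℝ, (∀ f, μ < m f) →
        ∃ (z shift : QCDField Nf → ℕ → ℝ) (T : OSData (QCDField Nf) 4),
          IsQCDAlong (reg.scheme m z shift) T ∧ T.IsNontrivial QCDField.glue ∧ T.IsNonGaussian QCDField.glue ∧
            (∀ f g : Fin Nf, f ≠ g → T.IsNontrivial (QCDField.pseudoRe f g)) ∧
              ∃ Δ > 0, T.HasMassGap Δ ∧ (reg.scheme m z shift).HasLatticeMassGap Δ)
    (hQ1 : ∀ Nf : ℕ, (Nf = 2 ∨ Nf = 3) → ∀ reg : QCDRegularisation Nf, reg.HasMassScaling →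
      (∀ m : Fin Nf → ℝ,
        ∃ (z shift : QCDField Nf → ℕ → ℝ) (T : OSData (QCDField Nf) 4),
          IsQCDAlong (reg.scheme m z shift) T ∧ T.IsNontrivial QCDField.glue ∧ T.IsNonGaussian QCDField.glue ∧
            (∀ f g : Fin Nf, f ≠ g → T.IsNontrivial (QCDField.pseudoRe f g)) ∧
              ∃ Δ > 0, T.HasMassGap Δ ∧ (reg.scheme m z shift).HasLatticeMassGap Δ) →
      ∃ μ : ℝ, ∀ ε > (0 : ℝ), ∃ m : Fin Nf → ℝ, (∀ f, μ < m f) ∧ ¬ (reg.scheme m 0 0).HasLatticeMassGap ε)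
    (hQ2 : ∀ Nf : ℕ, (Nf = 2 ∨ Nf = 3) → ∀ reg : QCDRegularisation Nf, reg.HasMassScaling →
      (∃ c : ℝ, -1 < c ∧ ∀ᶠ k in atTop, c ≤ reg.mcrit k) → ∀ μ : ℝ,
      (∀ m : Fin Nf → ℝ, (∀ f, μ < m f) →
        ∃ (z shift : QCDField Nf → ℕ → ℝ) (T : OSData (QCDField Nf) 4),
          IsQCDAlong (reg.scheme m z shift) T ∧ T.IsNontrivial QCDField.glue ∧ T.IsNonGaussian QCDField.glue ∧
            (∀ f g : Fin Nf, f ≠ g → T.IsNontrivial (QCDField.pseudoRe f g)) ∧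
              ∃ Δ > 0, T.HasMassGap Δ ∧ (reg.scheme m z shift).HasLatticeMassGap Δ) →
      (∃ ε > (0 : ℝ), ∀ m : Fin Nf → ℝ, (∀ f, μ < m f) → (reg.scheme m 0 0).HasLatticeMassGap ε) →
      ∃ μ' : ℝ, μ' < μ ∧ ∃ ε > (0 : ℝ), ∀ m : Fin Nf → ℝ, (∀ f, μ' < m f) → (reg.scheme m 0 0).HasLatticeMassGap ε)
    (hQ3 : ∀ Nf : ℕ, (Nf = 2 ∨ Nf = 3) → ∀ reg : QCDRegularisation Nf, reg.HasMassScaling →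
      (∃ c : ℝ, -1 < c ∧ ∀ᶠ k in atTop, c ≤ reg.mcrit k) → ∀ μ ν : ℝ, μ < ν →
      (∃ ε > (0 : ℝ), ∀ m : Fin Nf → ℝ, (∀ f, μ < m f) → (reg.scheme m 0 0).HasLatticeMassGap ε) →
      (∀ m : Fin Nf → ℝ, (∀ f, ν < m f) →
        ∃ (z shift : QCDField Nf → ℕ → ℝ) (T : OSData (QCDField Nf) 4),
          IsQCDAlong (reg.scheme m z shift) T ∧ T.IsNontrivial QCDField.glue ∧ T.IsNonGaussian QCDField.glue ∧
            (∀ f g : Fin Nf, f ≠ g → T.IsNontrivial (QCDField.pseudoRe f g)) ∧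
              ∃ Δ > 0, T.HasMassGap Δ ∧ (reg.scheme m z shift).HasLatticeMassGap Δ) →
      ∃ δ > (0 : ℝ), ∀ m : Fin Nf → ℝ, (∀ f, ν - δ < m f) →
        ∃ (z shift : QCDField Nf → ℕ → ℝ) (T : OSData (QCDField Nf) 4),
          IsQCDAlong (reg.scheme m z shift) T ∧ T.IsNontrivial QCDField.glue ∧ T.IsNonGaussian QCDField.glue ∧
            (∀ f g : Fin Nf, f ≠ g → T.IsNontrivial (QCDField.pseudoRe f g)) ∧
              ∃ Δ > 0, T.HasMassGap Δ ∧ (reg.scheme m z shift).HasLatticeMassGap Δ) :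
    Summit.QuantumFields.QCD.Theses.SpectralDefectExtinction.ChiralDescent := by
  unfold Summit.QuantumFields.QCD.Theses.SpectralDefectExtinction.ChiralDescent
  rintro Nf hNf ⟨reg, hMS, M₁, -, hbody⟩
  have hNf0 : 0 < Nf := nf_pos hNf
  by_cases hint : ∃ c : ℝ, -1 < c ∧ ∀ᶠ k in atTop, c ≤ reg.mcrit k
  · -- interior: the gap-upset descent
    obtain ⟨μ, hB, hG⟩ := chiralPointOfThreshold_of_gapUpset hNf0 reg (hQ1 Nf hNf reg hMS)
      (hQ2 Nf hNf reg hMS hint) (hQ3 Nf hNf reg hMS hint) hbody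
    exact qcdOf_of_bodyAbove_of_noUniformGapAbove reg hMS μ hB hG
  · -- the wall regime: lim inf m_crit ≤ −1
    exfalso
    have hwall : ∀ c : ℝ, -1 < c → ∃ᶠ k in atTop, reg.mcrit k < c := by
      intro c hc
      have hnev : ¬ ∀ᶠ k in atTop, c ≤ reg.mcrit k := fun hev => hint ⟨c, hc, hev⟩
      simpa only [Filter.not_eventually, not_le] using hnev
    exact hW Nf hNf reg hMS hwall M₁ hbody

/-- **THE INTERIOR RE-TYPE NEEDS NO WALL STUB** (lead c11's planner recommendation, kernel-checked): if the crux antecedent — the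
threshold body, i.e. the conclusion of the bridge `ExtinctionBuildsQCD` — is re-typed to carry the INTERIOR clause
`∃ c > −1, ∀ᶠ k, c ≤ reg.mcrit k` (free for every honest bridge: the Wilson critical mass of an asymptotically free trajectory tends to
`0⁻`, and a positive `m_crit`-shift keeps the clause under mass scaling), then `QCDOf N_f` follows from Q1, Q2, Q3 ALONE — the wall stub
(W / W_lim, open-problem grade: supercritical localisation) disappears from the line. [folklore] -/
theorem ChiralDescentInterior_of_stubs
    (hQ1 : ∀ Nf : ℕ, (Nf = 2 ∨ Nf = 3) → ∀ reg : QCDRegularisation Nf, reg.HasMassScaling →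
      (∀ m : Fin Nf → ℝ,
        ∃ (z shift : QCDField Nf → ℕ → ℝ) (T : OSData (QCDField Nf) 4),
          IsQCDAlong (reg.scheme m z shift) T ∧ T.IsNontrivial QCDField.glue ∧ T.IsNonGaussian QCDField.glue ∧
            (∀ f g : Fin Nf, f ≠ g → T.IsNontrivial (QCDField.pseudoRe f g)) ∧
              ∃ Δ > 0, T.HasMassGap Δ ∧ (reg.scheme m z shift).HasLatticeMassGap Δ) →
      ∃ μ : ℝ, ∀ ε > (0 : ℝ), ∃ m : Fin Nf → ℝ, (∀ f, μ < m f) ∧ ¬ (reg.scheme m 0 0).HasLatticeMassGap ε)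
    (hQ2 : ∀ Nf : ℕ, (Nf = 2 ∨ Nf = 3) → ∀ reg : QCDRegularisation Nf, reg.HasMassScaling →
      (∃ c : ℝ, -1 < c ∧ ∀ᶠ k in atTop, c ≤ reg.mcrit k) → ∀ μ : ℝ,
      (∀ m : Fin Nf → ℝ, (∀ f, μ < m f) →
        ∃ (z shift : QCDField Nf → ℕ → ℝ) (T : OSData (QCDField Nf) 4),
          IsQCDAlong (reg.scheme m z shift) T ∧ T.IsNontrivial QCDField.glue ∧ T.IsNonGaussian QCDField.glue ∧
            (∀ f g : Fin Nf, f ≠ g → T.IsNontrivial (QCDField.pseudoRe f g)) ∧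
              ∃ Δ > 0, T.HasMassGap Δ ∧ (reg.scheme m z shift).HasLatticeMassGap Δ) →
      (∃ ε > (0 : ℝ), ∀ m : Fin Nf → ℝ, (∀ f, μ < m f) → (reg.scheme m 0 0).HasLatticeMassGap ε) →
      ∃ μ' : ℝ, μ' < μ ∧ ∃ ε > (0 : ℝ), ∀ m : Fin Nf → ℝ, (∀ f, μ' < m f) → (reg.scheme m 0 0).HasLatticeMassGap ε)
    (hQ3 : ∀ Nf : ℕ, (Nf = 2 ∨ Nf = 3) → ∀ reg : QCDRegularisation Nf, reg.HasMassScaling →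
      (∃ c : ℝ, -1 < c ∧ ∀ᶠ k in atTop, c ≤ reg.mcrit k) → ∀ μ ν : ℝ, μ < ν →
      (∃ ε > (0 : ℝ), ∀ m : Fin Nf → ℝ, (∀ f, μ < m f) → (reg.scheme m 0 0).HasLatticeMassGap ε) →
      (∀ m : Fin Nf → ℝ, (∀ f, ν < m f) →
        ∃ (z shift : QCDField Nf → ℕ → ℝ) (T : OSData (QCDField Nf) 4),
          IsQCDAlong (reg.scheme m z shift) T ∧ T.IsNontrivial QCDField.glue ∧ T.IsNonGaussian QCDField.glue ∧
            (∀ f g : Fin Nf, f ≠ g → T.IsNontrivial (QCDField.pseudoRe f g)) ∧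
              ∃ Δ > 0, T.HasMassGap Δ ∧ (reg.scheme m z shift).HasLatticeMassGap Δ) →
      ∃ δ > (0 : ℝ), ∀ m : Fin Nf → ℝ, (∀ f, ν - δ < m f) →
        ∃ (z shift : QCDField Nf → ℕ → ℝ) (T : OSData (QCDField Nf) 4),
          IsQCDAlong (reg.scheme m z shift) T ∧ T.IsNontrivial QCDField.glue ∧ T.IsNonGaussian QCDField.glue ∧
            (∀ f g : Fin Nf, f ≠ g → T.IsNontrivial (QCDField.pseudoRe f g)) ∧
              ∃ Δ > 0, T.HasMassGap Δ ∧ (reg.scheme m z shift).HasLatticeMassGap Δ) :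
    ∀ Nf : ℕ, (Nf = 2 ∨ Nf = 3) →
      (∃ reg : QCDRegularisation Nf, reg.HasMassScaling ∧ (∃ c : ℝ, -1 < c ∧ ∀ᶠ k in atTop, c ≤ reg.mcrit k) ∧
        ∃ M₁ : ℝ, 0 ≤ M₁ ∧ ∀ m : Fin Nf → ℝ, (∀ f, M₁ < m f) →
          ∃ (z shift : QCDField Nf → ℕ → ℝ) (T : OSData (QCDField Nf) 4),
            IsQCDAlong (reg.scheme m z shift) T ∧ T.IsNontrivial QCDField.glue ∧ T.IsNonGaussian QCDField.glue ∧
              (∀ f g : Fin Nf, f ≠ g → T.IsNontrivial (QCDField.pseudoRe f g)) ∧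
                ∃ Δ > 0, T.HasMassGap Δ ∧ (reg.scheme m z shift).HasLatticeMassGap Δ) →
      QCDOf Nf := by
  rintro Nf hNf ⟨reg, hMS, hint, M₁, -, hbody⟩
  obtain ⟨μ, hB, hG⟩ := chiralPointOfThreshold_of_gapUpset (nf_pos hNf) reg (hQ1 Nf hNf reg hMS)
    (hQ2 Nf hNf reg hMS hint) (hQ3 Nf hNf reg hMS hint) hbody
  exact qcdOf_of_bodyAbove_of_noUniformGapAbove reg hMS μ hB hG

/-- **The crux BY NAME, modulo the four registered stubs** (gap-upset recut): see the module docstring for the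
composition. [folklore] -/
theorem ChiralDescent_of : Summit.QuantumFields.QCD.Theses.SpectralDefectExtinction.ChiralDescent :=
  ChiralDescent_of_stubs stub_wallNoGo stub_chiralPointOfBodyEverywhere stub_gapUpsetNoStart stub_bodyIntoGap

end Summit.QuantumFields.QCD.Cruxes.ChiralDescent.GapUpsetRecut
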